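import Summits.BirchSwinnertonDyer.BirchSwinnertonDyer.Theorems.KimAtThreeDeepLowerOffStratumLevelLoweringMultiStabRowsRam
import Summits.BirchSwinnertonDyer.BirchSwinnertonDyer.Theorems.KimAtThreeDeepLowerOffStratumLevelLoweringMultiStabRowsClass
import Literature.NumberTheory.EllipticCurves.LevelLoweringGamma0AtThreeGeneralLevel
import Literature.NumberTheory.EllipticCurves.NeronTamagawa
import Literature.NumberTheory.EllipticCurves.NeronComponentDataProofs
import Literature.NumberTheory.EllipticCurves.TamagawaRingEquivProofs
import Literature.NumberTheory.EllipticCurves.BSDRootNumberLocalTablesProofs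
import Literature.NumberTheory.EllipticCurves.ManinConstantQuadraticTwistClassCertificate
import Literature.NumberTheory.DiophantineGeometry.TateAlgorithmRingEquivProofs
import HarnessLib

/-!
# Route `KimAtThreeKolyvagin` (rung W2), crux `DeepLowerAtThreeOffKatoStratum` (item 19679), registered
# stub `stub_nonAdditive`: the CLASS «(ram), ordinary-if-good, `v₃(∏ c_ℓ) = 1`, no additive place of Kodaira
# type `IV`/`IV*`» at ANY conductor, WITHOUT row data

Cell `bsd-addord`, seat `bsd-addord-w2-acc2`, gen 7; item `stmt-BirchSwinnertonDyer-19679` (`--supports`, closes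
nothing). Gen 6's ★⁶ (`…MultiStabRowsClass`) is the class theorem on SEMISTABLE curves; THIS FILE is its twin on
NON-SEMISTABLE curves (additive primes `p ≠ 3` allowed in the conductor). ★⁷ (`…MultiStabRowsRam`) closes the
depth-`1` rows with (ram) GIVEN the decomposition `N = M₀·D·q` and the optimal-level newform; here `q` (the
Tamagawa-`3` prime: split multiplicative, `3 ∣ ord_q Δ`), `D` (the other unramified MULTIPLICATIVE primes `r ∥ N`,
`3 ∣ ord_r Δ`) and `M₀ = N/(Dq)` are CONSTRUCTED from the curve, and the newform is the NEW Literature named fact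
`ribet1990_levelLowering_gamma0_newform_at_three_general` (Darmon–Diamond–Taylor Thm. 3.15 + Lemma 2.7: at an additive
`p` with `3 ∤ #Φ_p(𝔽̄_p)` the optimal level keeps `p^{f_p}`). The one extra class condition «`3 ∤ #Φ_v(𝔽̄_v)` at
every additive place» serves twice: it is the fact's Kodaira clause AND it forces the Tamagawa-`3` to sit at a
multiplicative prime (`c_v ∣ #Φ_v(𝔽̄_v)`). Theorems only; nothing booked; BSD is not proved by any of this.

* §1 `three_dvd_componentGroupOrder_of_three_dvd_localTamagawaNumber_padic` (`c_p ∣ #Φ_p(𝔽̄_p)`, read at the place of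
  `ℤ`), `exists_split_prime_of_three_dvd_tamagawaProduct_of_kodaira` (the Tamagawa-`3` prime of a curve with no
  additive `IV`/`IV*` place: split multiplicative, `q ∥ N`, `3 ∣ ord_q Δ`).
* §2 `exists_decomposition_exactlyDividing` (pure arithmetic: `N' = M₀·D`, `D` = the product of the primes `r ∥ N'`
  with a given property, squarefree and prime to `M₀`).
* §3 ★⁸ `stub_nonAdditive_ram_tamagawaDepthOne_of_kodaira`.
[cite: DarmonDiamondTaylor1995, Thm. 3.15, Lemma 2.7] [cite: SilvermanATAEC1994, Cor. IV.9.2 (d), Table 4.1, §IV.10]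
[cite: Skinner2016PacificMC, Thm. C (§1)] [cite: Vatsal1999, §1 (1.6), Thm. (1.13)] [cite: Ribet1984ICM, Thm. 4.1]
-/

set_option autoImplicit false
-- the Theorems namespace of a single-conjunct summit repeats the summit name by design (D-0017)
set_option linter.dupNamespace false

noncomputable section

open scoped MatrixGroups ModularForm Classical NNReal NumberField

open CongruenceSubgroup WeierstrassCurve Literature.NumberTheory.EllipticCurves
  Literature.NumberTheory.EllipticCurves.ModularForms IsDedekindDomain NumberField Rat.HeightOneSpectrum

namespace Summit.BirchSwinnertonDyer.BirchSwinnertonDyer.Theorems.KimAtThreeDeepLowerOffStratumLevelLoweringMultiStabRowsRamClass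

open Summit.BirchSwinnertonDyer.BirchSwinnertonDyer.Theorems.KimAtThreeDeepLowerOffStratumLevelLoweringMultiStabRowsRam
open Summit.BirchSwinnertonDyer.BirchSwinnertonDyer.Theorems.KimAtThreeDeepLowerOffStratumLevelLoweringMultiStabRowsClass
  (split_and_three_dvd_of_three_dvd_localTamagawaNumber)
open Summit.BirchSwinnertonDyer.BirchSwinnertonDyer.Theorems.KimAtThreeShallowEqDeepOffStratumNonAdditiveRows
  (not_sq_dvd_conductorNorm_of_not_addv)
open Literature.NumberTheory.EllipticCurves.Rank1Residual Literature.NumberTheory.EllipticCurves.Rank1Residual.Typed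
  Literature.NumberTheory.EllipticCurves.Skinner2016 Literature.NumberTheory.Automorphic

/-! ### §1 The Tamagawa-`3` prime of a curve with no additive place of type `IV`, `IV*` -/

section Tamagawa

variable (W : WeierstrassCurve ℚ) [W.IsElliptic]

/-- **`c_p ∣ #Φ_p(𝔽̄_p)` read at the place of `ℤ` over `p`**: if `3 ∣ c_p` (the `p`-adic local Tamagawa number)
then `3` divides the component-group order of the Kodaira symbol at the place `v` of `ℤ` over `p` (Kodaira–Néron:
`c_p = #Φ_p(𝔽_p)` is the order of a subgroup of `Φ_p(𝔽̄_p)`; the Kodaira symbol does not depend on whether `p` is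
viewed as a prime of `ℤ` or of `𝓞 ℚ`, both being Tate's algorithm over `ℤ_p`).
[cite: SilvermanATAEC1994, Cor. IV.9.2 (c), (d) and Table 4.1] -/
theorem three_dvd_componentGroupOrder_of_three_dvd_localTamagawaNumber_padic (p : ℕ) [hp : Fact p.Prime]
    (h3 : 3 ∣ (W.baseChange ℚ_[p]).localTamagawaNumber ℤ_[p]) (v : HeightOneSpectrum ℤ)
    (hv : (primesEquiv v : ℕ) = p) : 3 ∣ (W.kodairaSymbolAt v).componentGroupOrder := by
  have _inst (q : Nat.Primes) : Fact q.1.Prime := ⟨q.2⟩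
  set v' : HeightOneSpectrum (𝓞 ℚ) := placeOfPrime p with hv'def
  have hv' : (primesEquiv v' : ℕ) = p := primesEquiv_placeOfPrime p
  haveI : Finite (IsLocalRing.ResidueField (v'.adicCompletionIntegers ℚ)) :=
    HeightOneSpectrum.finite_residueField_adicCompletionIntegers ℚ v'
  rw [localTamagawaNumber_padic_eq_holds W v' p hv'] at h3
  have hd := localTamagawaNumber_dvd_componentGroupOrder v' W (nonempty_neronComponentData_holds W v')
  have key : ∀ q₁ q₂ : Nat.Primes, q₁ = q₂ →
      (W.baseChange ℚ_[q₁]).kodairaSymbol ℤ_[q₁] = (W.baseChange ℚ_[q₂]).kodairaSymbol ℤ_[q₂] := by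
    rintro _ _ rfl; rfl
  have hq₁ : primesEquiv v' = ⟨p, hp.out⟩ := Subtype.ext hv'
  have hq₂ : primesEquiv v = ⟨p, hp.out⟩ := Subtype.ext hv
  have heq : W.kodairaSymbolAt v = W.kodairaSymbolAt v' := by
    rw [kodairaSymbolAt_eq_padic v W, kodairaSymbolAt_eq_padic v' W]
    exact key _ _ (hq₂.trans hq₁.symm)
  rw [heq]
  exact h3.trans hd

variable [W.IsGloballyMinimal]

/-- **The Tamagawa-`3` prime of a curve with no additive place of Kodaira type `IV`, `IV*`**: if `3 ∣ ∏_ℓ c_ℓ(E)`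
and `3 ∤ #Φ_v(𝔽̄_v)` at every place of ADDITIVE reduction, then some prime `q ∥ N` has SPLIT multiplicative
reduction with `3 ∣ ord_q(Δ_min)` (`Tam(E) = ∏_{bad v} c_v`; `3` divides one factor `c_v`; `v` additive is excluded
since `c_v ∣ #Φ_v(𝔽̄_v)`; so `v` is multiplicative and gen 6's `split_and_three_dvd_of_three_dvd_localTamagawaNumber`
applies; `q² ∤ N` at a multiplicative prime, `f_q = 1`). [cite: SilvermanATAEC1994, Cor. IV.9.2 (d), IV.9.4 Step 2, Thm. IV.10.2]
[cite: SilvermanAEC2009, Thm. VII.6.1] -/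
theorem exists_split_prime_of_three_dvd_tamagawaProduct_of_kodaira (h3 : 3 ∣ W.tamagawaProduct)
    (hK : ∀ v : HeightOneSpectrum ℤ, W.HasAdditiveReductionAt v → ¬ 3 ∣ (W.kodairaSymbolAt v).componentGroupOrder) :
    ∃ (q : ℕ) (_ : Fact q.Prime), q ∣ W.conductorNorm ℤ ∧ ¬ q ^ 2 ∣ W.conductorNorm ℤ ∧
      W.HasSplitMultiplicativeReductionAtPrime q ∧ (3 : ℤ) ∣ padicValRat q W.Δ := by
  have hfW : (W.badPlaces ℤ).Finite := W.finite_badPlaces_holds ℤ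
  set s : Finset (HeightOneSpectrum ℤ) := hfW.toFinset with hsdef
  have hsW : ∀ w, ¬ W.HasGoodReductionAt w → w ∈ s := fun w hw ↦ by
    rw [hsdef, Set.Finite.mem_toFinset, mem_badPlaces_iff]; exact hw
  rw [tamagawaProduct_eq_prod W s hsW] at h3
  obtain ⟨v, hv, hdv⟩ := Nat.prime_three.prime.exists_mem_finset_dvd h3
  haveI := Fact.mk (primesEquiv v).2
  have hbad : ¬ W.HasGoodReductionAt v := by
    rw [hsdef, Set.Finite.mem_toFinset, mem_badPlaces_iff] at hv; exact hv
  have hbad' : ¬ W.HasGoodReductionAtPrime (primesEquiv v : ℕ) := fun hgood ↦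
    hbad ((WeierstrassCurve.hasGoodReductionAtPrime_primesEquiv_iff_hasGoodReductionAt W v).mp hgood)
  -- the place is multiplicative: an additive place would have `3 ∣ c_v ∣ #Φ_v(k̄)`
  have hmultv : W.HasMultiplicativeReductionAt v := by
    rcases hasGoodReductionAt_or_hasMultiplicativeReductionAt_or_hasAdditiveReductionAt v W with hg | hm | ha
    · exact absurd hg hbad
    · exact hm
    · exact absurd (three_dvd_componentGroupOrder_of_three_dvd_localTamagawaNumber_padic W _ hdv v rfl) (hK v ha)
  have hmult : W.HasMultiplicativeReductionAtPrime (primesEquiv v : ℕ) :=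
    (hasMultiplicativeReductionAtPrime_primesEquiv_iff_hasMultiplicativeReductionAt W v).mpr hmultv
  have hN : (primesEquiv v : ℕ) ∣ W.conductorNorm ℤ := by
    by_contra h
    exact hbad' (hasGoodReductionAtPrime_of_not_dvd_conductorNorm W h)
  have hN2 : ¬ (primesEquiv v : ℕ) ^ 2 ∣ W.conductorNorm ℤ := by
    change ¬ natGenerator v ^ 2 ∣ W.conductorNorm ℤ
    rw [natGenerator_sq_dvd_conductorNorm_iff v W]
    exact hmultv.not_hasAdditiveReductionAt
  obtain ⟨hs, hord⟩ := split_and_three_dvd_of_three_dvd_localTamagawaNumber W (primesEquiv v : ℕ) hmult hdv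
  exact ⟨(primesEquiv v : ℕ), inferInstance, hN, hN2, hs, hord⟩

end Tamagawa

/-! ### §2 Sorting the exactly-dividing primes of `N'` (pure arithmetic) -/

section Arithmetic

/-- **Sorting the exactly-dividing prime factors of `N'`**: for a property `P` of primes, let `D` be the product
of the primes `r` with `r ∥ N'` and `P r`; then `N' = M₀·D` with `D` squarefree and prime to `M₀`, every prime
factor of `D` is `∥ N'` and satisfies `P`, and no prime `p ∥ N'` dividing `M₀` satisfies `P`. [folklore] -/
theorem exists_decomposition_exactlyDividing {N' : ℕ} (hN' : N' ≠ 0) (P : ℕ → Prop) :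
    ∃ M₀ D : ℕ, M₀ * D = N' ∧ Squarefree D ∧ Nat.Coprime D M₀ ∧
      (∀ r : ℕ, r.Prime → r ∣ D → P r ∧ ¬ r ^ 2 ∣ N') ∧
      (∀ p : ℕ, p.Prime → p ∣ M₀ → ¬ p ^ 2 ∣ N' → ¬ P p) := by
  classical
  set S : Finset ℕ := N'.primeFactors.filter (fun r ↦ P r ∧ ¬ r ^ 2 ∣ N') with hS
  set D : ℕ := ∏ r ∈ S, r with hD
  have hSsub : S ⊆ N'.primeFactors := Finset.filter_subset _ _
  have hSp : ∀ r ∈ S, r.Prime := fun r hr ↦ Nat.prime_of_mem_primeFactors (hSsub hr)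
  have hDdvd : D ∣ N' :=
    Finset.prod_primes_dvd N' (fun r hr ↦ (hSp r hr).prime) fun r hr ↦ Nat.dvd_of_mem_primeFactors (hSsub hr)
  obtain ⟨M₀, hM₀⟩ := hDdvd
  -- prime factors of `D` are the members of `S`
  have hmem : ∀ r : ℕ, r.Prime → r ∣ D → r ∈ S := by
    intro r hr hrD
    obtain ⟨r', hr'S, hrr'⟩ := hr.prime.exists_mem_finset_dvd hrD
    obtain rfl : r = r' := (Nat.prime_dvd_prime_iff_eq hr (hSp r' hr'S)).mp hrr'
    exact hr'S
  have hPD : ∀ r : ℕ, r.Prime → r ∣ D → P r ∧ ¬ r ^ 2 ∣ N' := fun r hr hrD ↦ (Finset.mem_filter.mp (hmem r hr hrD)).2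
  refine ⟨M₀, D, by rw [mul_comm, ← hM₀], ?_, ?_, hPD, ?_⟩
  · -- squarefree: a square prime factor of `D` would be a square factor of `N'`
    refine Nat.squarefree_iff_prime_squarefree.mpr fun r hr hrr ↦ ?_
    have hrD : r ∣ D := (dvd_mul_right r r).trans hrr
    exact (hPD r hr hrD).2 (by rw [pow_two, hM₀]; exact hrr.mul_right M₀)
  · -- coprime: a common prime `r` gives `r² ∣ D M₀ = N'`
    refine Nat.coprime_of_dvd fun r hr hrD hrM ↦ ?_
    exact (hPD r hr hrD).2 (by rw [pow_two, hM₀]; exact mul_dvd_mul hrD hrM)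
  · intro p hp hpM hp2 hP
    have hpN' : p ∣ N' := by rw [hM₀]; exact hpM.mul_left D
    have hpS : p ∈ S := Finset.mem_filter.mpr ⟨Nat.mem_primeFactors.mpr ⟨hp, hpN', hN'⟩, hP, hp2⟩
    have hpD : p ∣ D := Finset.dvd_prod_of_mem (fun r ↦ r) hpS
    exact hp2 (by rw [pow_two, hM₀]; exact mul_dvd_mul hpD hpM)

end Arithmetic

/-! ### §3 ★⁸ The class theorem: (ram), no additive `IV`/`IV*`, no row data -/

section Class

/-- ★⁸ **`stub_nonAdditive` (crux 19679 `DeepLowerAtThreeOffKatoStratum`) on the CLASS of depth-`1` rows WITH (ram) and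
NO ADDITIVE PLACE OF KODAIRA TYPE `IV`, `IV*`, at ANY conductor — stub binders VERBATIM + «ordinary if good at `3`» +
`Ram W₀ 3` + `v₃(∏ c_ℓ) ≤ 1` + `3 ∣ ∏ c_ℓ` + «`3 ∤ #Φ_v(𝔽̄_v)` at every additive place `v`» — from TEN NAMED FACTS
and NOTHING ELSE** (no decomposition of `N`, no `ord_ℓ Δ` data): the Tamagawa-`3` prime `q` (§1), the unramified
multiplicative set `D` and the optimal level `M₀` (§2 with `P r := 3 ∣ ord_r Δ` on `N' = N/q`) are constructed from the
curve, the level-lowered newform is the NEW named fact `ribet1990_levelLowering_gamma0_newform_at_three_general`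
(`hRk`) at the removed set `Dq`, and ★⁷ (`…MultiStabRowsRam.stub_nonAdditive_ram_of_exists_levelLoweredNewform`) is
applied. The census class (Cremona `N < 5·10⁵`, optimal, `r = 0`, `v₃(∏ c) = 1`, `9 ∤ N`, `ρ̄₃` onto, ordinary if
good) this closes modulo named print: 31 130 NON-semistable rows (and the 29 656 semistable ones again).
[cite: DarmonDiamondTaylor1995, Thm. 3.15, Lemma 2.7 and Prop. 2.12] [cite: Diamond1995RefinedSerre, Thm. 6.4 and Cor. 6.5]
[cite: Ribet1990, Thm. 1.1] [cite: ColemanEdixhoven1998, Thm. 2.1] [cite: Vatsal1999, §1 (1.6), Thm. (1.13)]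
[cite: GreenbergVatsal2000, §3 (17)–(19)] [cite: Ribet1984ICM, Thm. 4.1] [cite: Skinner2016PacificMC, Thm. C (§1)]
[cite: Mazur1978, Cor. 4.1] [cite: Kim2022StructureSelmer, Conj. 1.10 (PDF p. 8)]
[cite: SilvermanATAEC1994, Cor. IV.9.2 (d), Table 4.1, §IV.10] -/
theorem stub_nonAdditive_ram_tamagawaDepthOne_of_kodaira
    (hRk : ribet1990_levelLowering_gamma0_newform_at_three_general)
    (hCE : colemanEdixhoven1998_heckePolynomial_simpleRoots)
    (hV : vatsal1999_plusSymbol_congruence) (hGV : greenbergVatsal2000_plusSymbol_congruence)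
    (hI : ribet1984_iharaLemma)
    (hSk : Skinner2016.thmC_padicValRat_bsd_rank_zero)
    (hmod : hasEntireLFunction_rat) (hGZK : rank_eq_analyticRank_of_analyticRank_le_one)
    (hM : mazur_not_dvd_maninConstant_of_odd) :
    ∀ (W₀ : WeierstrassCurve ℚ) [W₀.IsElliptic] [W₀.IsGloballyMinimal],
      (∀ n : ℕ, W₀.HasSurjectiveModNGaloisRep (3 ^ n : ℕ)) → Finite W₀.sha →
      ∀ {N : ℕ} [NeZero N], N = W₀.conductorNorm ℤ →
      ∀ (D₀ : ModularParametrizationData W₀ N),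
        (∀ z ∈ D₀.L.lattice, ∃ w ∈ periodLattice D₀.f, z = D₀.c * w) →
        (∀ (W₂ : WeierstrassCurve ℚ) [W₂.IsElliptic] (D₂ : ModularParametrizationData W₂ N),
          D₂.f = D₀.f → D₀.modularDegree ≤ D₂.modularDegree) →
        (∀ r : ℚ, ratPlusSymbol D₀.f r ≠ 0 → 0 ≤ padicValRat 3 (ratPlusSymbol D₀.f r)) →
        kuriharaVanishingOrder W₀ 3 D₀.f = 0 →
        ¬ (haveI : Fact (Nat.Prime 3) := ⟨Nat.prime_three⟩; Addv W₀ 3) →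
        (W₀.HasGoodReductionAtPrime 3 → ¬ (3 : ℤ) ∣ W₀.frobeniusTrace 3) →
        (haveI : Fact (Nat.Prime 3) := ⟨Nat.prime_three⟩; Ram W₀ 3) →
        padicValNat 3 W₀.tamagawaProduct ≤ 1 → 3 ∣ W₀.tamagawaProduct →
        (∀ v : HeightOneSpectrum ℤ, W₀.HasAdditiveReductionAt v → ¬ 3 ∣ (W₀.kodairaSymbolAt v).componentGroupOrder) →
        ∃ d : ℕ, kuriharaPartialDeepInfty W₀ 3 D₀.f = d ∧
          kuriharaPartial W₀ 3 D₀.f 0 ≤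
            ((padicValNat 3 (Nat.card (AddCommGroup.primaryComponent W₀.sha 3)) + d : ℕ) : ℕ∞) := by
  intro W₀ _ _ htower hfin N _ hN D₀ hopt hdeg hint hord hnA hordinary hram hv h3 hK
  have hsurj : W₀.HasSurjectiveModNGaloisRep 3 := by simpa using htower 1
  have h9 : ¬ 3 ^ 2 ∣ N := hN ▸ not_sq_dvd_conductorNorm_of_not_addv W₀ hnA
  have hf := D₀.isNewformOf
  -- §1: the Tamagawa-`3` prime `q ∥ N`
  obtain ⟨q, hqF, hqN, hqN2, hsplit, hqΔ⟩ := exists_split_prime_of_three_dvd_tamagawaProduct_of_kodaira W₀ h3 hK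
  have hq : q.Prime := hqF.out
  rw [← hN] at hqN hqN2
  obtain ⟨N', hN'⟩ := hqN
  have hN'0 : N' ≠ 0 := fun h ↦ NeZero.ne N (by rw [hN', h, mul_zero])
  have hqN' : ¬ q ∣ N' := fun h ↦ hqN2 (by rw [pow_two, hN']; exact mul_dvd_mul_left q h)
  -- §2: `N' = M₀·D`, `D` = the primes `r ∥ N'` with `3 ∣ ord_r Δ`
  obtain ⟨M₀, D, hMD, hDsq, hDM₀, hDP, hM₀P⟩ :=
    exists_decomposition_exactlyDividing hN'0 (fun r ↦ (3 : ℤ) ∣ padicValRat r W₀.Δ)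
  haveI : NeZero M₀ := ⟨fun h ↦ hN'0 (by rw [← hMD, h, zero_mul])⟩
  have hMDq : M₀ * D * q = N := by rw [hMD, hN', mul_comm]
  have hqMD : ¬ q ∣ M₀ * D := by rw [hMD]; exact hqN'
  have hqM₀ : ¬ q ∣ M₀ := fun h ↦ hqMD (h.mul_right D)
  have hqD : ¬ q ∣ D := fun h ↦ hqMD (h.mul_left M₀)
  -- the signs `a_p(f) = ±1` at the (multiplicative) primes of `D`
  have hsign : ∀ p : ℕ, p.Prime → p ∣ D → ∃ u : ℤ, u * u = 1 ∧ cuspCoeff D₀.f p = u := by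
    intro p hp hpD
    haveI : Fact p.Prime := ⟨hp⟩
    have hpq : p ≠ q := fun h ↦ hqD (h ▸ hpD)
    have hpN : p ∣ W₀.conductorNorm ℤ := by
      rw [← hN, ← hMDq]
      exact (hpD.mul_left M₀).mul_right q
    have hp2 : ¬ p ^ 2 ∣ W₀.conductorNorm ℤ := by
      intro h
      rw [← hN, ← hMDq, hMD, pow_two] at h
      have h' : p * p ∣ N' := by
        have hcop : Nat.Coprime (p * p) q :=
          Nat.Coprime.mul_left ((Nat.coprime_primes hp hq).mpr hpq) ((Nat.coprime_primes hp hq).mpr hpq)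
        exact hcop.dvd_of_dvd_mul_right h
      exact (hDP p hp hpD).2 (by rw [pow_two]; exact h')
    rcases hasGoodReductionAtPrime_or_hasMultiplicativeReductionAtPrime_of_not_sq_dvd_conductorNorm (V := W₀) hp2
      with hgood | hmult
    · exact absurd hpN (not_dvd_conductorNorm_of_hasGoodReductionAtPrime W₀ hgood)
    · by_cases hs : W₀.HasSplitMultiplicativeReductionAtPrime p
      · refine ⟨1, by norm_num, ?_⟩
        rw [hf.2 p, W₀.LFunction_apply_prime_of_hasSplitMultiplicativeReductionAtPrime p hs]
      · refine ⟨-1, by norm_num, ?_⟩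
        rw [hf.2 p, W₀.LFunction_apply_prime_of_hasMultiplicativeReductionAtPrime_of_not_split p hmult hs]
  -- the optimal-level newform from the general-level fact BY NAME, at the removed set `D q`
  have hsqDq : Squarefree (D * q) :=
    (Nat.squarefree_mul ((Nat.Prime.coprime_iff_not_dvd hq).mpr hqD).symm).mpr ⟨hDsq, hq.prime.squarefree⟩
  have hcopDq : Nat.Coprime (D * q) M₀ :=
    Nat.Coprime.mul_left hDM₀ ((Nat.Prime.coprime_iff_not_dvd hq).mpr hqM₀)
  have hDqΔ : ∀ r : ℕ, r.Prime → r ∣ D * q → (3 : ℤ) ∣ padicValRat r W₀.Δ := by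
    intro r hr hrDq
    rcases (Nat.Prime.dvd_mul hr).mp hrDq with h | h
    · exact (hDP r hr h).1
    · rw [(Nat.prime_dvd_prime_iff_eq hr hq).mp h]; exact hqΔ
  have hM₀Δ : ∀ p : ℕ, p.Prime → p ∣ M₀ → ¬ p ^ 2 ∣ M₀ → ¬ (3 : ℤ) ∣ padicValRat p W₀.Δ := by
    intro p hp hpM hp2
    refine hM₀P p hp hpM fun h ↦ hp2 ?_
    -- `p² ∣ N' = M₀ D` with `p ∤ D` (coprime) gives `p² ∣ M₀`
    have hpD : ¬ p ∣ D := fun h' ↦ hp.ne_one (Nat.dvd_one.mp (by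
      have hg := Nat.dvd_gcd h' hpM
      rwa [Nat.Coprime.gcd_eq_one hDM₀] at hg))
    have hcop : Nat.Coprime (p ^ 2) D := (Nat.Coprime.pow_left 2 ((Nat.Prime.coprime_iff_not_dvd hp).mpr hpD))
    rw [← hMD] at h
    exact hcop.dvd_of_dvd_mul_right h
  have h3Δ : 3 ∣ M₀ → ¬ (3 : ℤ) ∣ padicValRat 3 W₀.Δ := by
    intro h3M
    refine hM₀Δ 3 Nat.prime_three h3M fun h9M ↦ h9 ?_
    rw [← hMDq]
    exact (h9M.mul_right D).mul_right q
  have hex : ∀ ι : PadicAlgCl 3 ≃+* ℂ, ∃ g : CuspForm (Gamma0 M₀) 2, IsNewform0 g ∧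
      (∀ p : ℕ, p.Prime → ¬ p ∣ D * q → Valued.v (ι.symm (cuspCoeff D₀.f p - cuspCoeff g p)) < 1) ∧
      (∀ p : ℕ, p.Prime → p ∣ D * q → Valued.v (ι.symm (cuspCoeff g p - cuspCoeff D₀.f p * (p + 1))) < 1) :=
    fun ι ↦ hRk W₀ hsurj (M₀ := M₀) (D := D * q) (by rw [← hMDq, mul_assoc]) hsqDq hcopDq h9 hN hDqΔ
      (fun p hp hpM hp2 _ ↦ hM₀Δ p hp hpM hp2) h3Δ hK D₀ ι
  exact stub_nonAdditive_ram_of_exists_levelLoweredNewform hCE hV hGV hI hSk hmod hGZK hM W₀ htower hfin hN D₀ hopt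
    hdeg hint hord hnA hordinary hram hv hMDq hsplit hqMD hDsq hDM₀ hsign hex

end Class

end Summit.BirchSwinnertonDyer.BirchSwinnertonDyer.Theorems.KimAtThreeDeepLowerOffStratumLevelLoweringMultiStabRowsRamClass

end
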